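import Mathlib
import Summits.NavierStokesRegularity.NavierStokesRegularity.Theorems.ThreadingFluxAzimuthalCartanConicalCorrespondence
import HarnessLib

/-!
# Crux `PoloidalLiouville` (stmt-NavierStokesRegularity-1222, wall W1), crux idea «azimuthal-cartan-test» (ns-idea-15 g10):
# ŠVERÁK'S CONFORMAL CORRESPONDENCE, CONSTRUCTIVE DIRECTION — the dynamics: `Δu`, `∇p`, steady Navier–Stokes (K♯ item 1, part 2)

Support file (`--supports stmt-NavierStokesRegularity-1222`, helper; cell `ns-wall-extremal`, width hand ns-wall-eng-6 g5, 0 kit).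
Sequel of `ThreadingFluxAzimuthalCartanConicalCorrespondence.lean` (objects `radialCoeff`, `conicalField`, `conicalPressure`, data
`LiouvilleCone U Φ g H`, and the kinematics: `div u = 0`, `curl u = c (g × x)` with `c = 2e^{Φ}/|x|²`, `H x = −g`, `tr H = −h`).  Here, for
Liouville data `hc : LiouvilleCone U Φ g H`:

* `LiouvilleCone.analyticAt_conicalField`, `…analyticAt_conicalPressure` — `u`, `p` are real-analytic on `U` (gradients of `C^ω` functions);
* `LiouvilleCone.curl_vorticity`, ★ `LiouvilleCone.laplacian_conicalField` — `Δu = c g + c(|g|² − h) x` through the LOCAL `Δ = −curl curl`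
  of ns-wall-eng-7 (`LocalCurlCurl.laplacian_eq_neg_curl_local`) applied to the vorticity field `ω = c (g × id)`:
  `curl ω = ∇c × (g × x) + c (2g + H x − (tr H) x) = −c g + c(h − |g|²) x` (`curl (a × ·) = 2a`, `curl (L · × b) = L b − (tr L) b`, BAC−CAB);
* `LiouvilleCone.gradient_conicalPressure` — `∇p = c g − (2h/|x|²) x − H g` (symmetry of `H`);
* ★ `LiouvilleCone.momentum` — `Du(u) + ∇p = Δu`, which closes on the one scalar relation `c h = h² + 2h/|x|²` (`c = h + 2/|x|²`);
* ★★ `LiouvilleCone.isSteadyNSOn`, `LiouvilleCone.isUnthreadedOn`, `LiouvilleCone.isMinusOneHomogeneousOn`,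
  `LiouvilleCone.analyticOnNhd_conicalField`, `LiouvilleCone.analyticOnNhd_conicalPressure`, bundled as ★★ `LiouvilleCone.correspondence`:
  LIOUVILLE DATA ON AN OPEN CONE PRODUCE A REAL-ANALYTIC CLASSICAL STEADY NS FLOW, UNTHREADED AND `(−1)`-HOMOGENEOUS ABOUT THE VERTEX,
  WITH VORTICITY `c (∇Φ × x)` — every clause of K♯ `PoloidalConicalFlows` but `curl ≢ 0` and NO AXIS (those depend on `Φ`; see the
  witness files `…ConicalWitness*`).

HONEST FRAME: steady, explicit, local vector calculus strictly below W1 (Šverák arXiv:math/0604550 §3–§4 proves the converse direction for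
flows smooth on all of `S²`; the tree has that one); closes no crux; `PoloidalLiouville` (1222) and NS regularity are OPEN / NOT proved.
-/

-- the summit and its single sub-problem share the name (CONVENTIONS §1)
set_option linter.dupNamespace false

noncomputable section

namespace Summit.NavierStokesRegularity.NavierStokesRegularity.Theorems.PoloidalLiouville.AzimuthalCartan

open Set Function Filter Topology Metric
open scoped ContDiff RealInnerProductSpace
open Literature.Analysis.FluidPDE
open Summit.NavierStokesRegularity.NavierStokesRegularity.Theorems.PoloidalLiouville.CentreJet (E3 IsSteadyNSOn)
open Summit.NavierStokesRegularity.NavierStokesRegularity.Cruxes.ScarEnvelopeTypeI.ForcedTsai (gradient_eq_of_hasFDerivAt_innerSL)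
open Summit.NavierStokesRegularity.NavierStokesRegularity.Theorems.PoloidalLiouville.AzimuthalCartan.HalfSpace (hasFDerivAt_div)
open Summit.NavierStokesRegularity.NavierStokesRegularity.Theorems.PoloidalLiouville.KinematicShadow (cross_smul_sub_smul_left)

namespace LiouvilleCone

variable {U : Set E3} {Φ : E3 → ℝ} {g : E3 → E3} {H : E3 → E3 →L[ℝ] E3} (hc : LiouvilleCone U Φ g H) {x : E3}
include hc

/-! ### Analyticity -/

/-- The radial coefficient is real-analytic on `U`. -/
theorem analyticAt_radialCoeff (hx : x ∈ U) : AnalyticAt ℝ (radialCoeff Φ) x := by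
  have hΦ := hc.analyticOnNhd x hx
  have hn : AnalyticAt ℝ (fun y : E3 => ‖y‖ ^ 2) x := ((contDiff_norm_sq ℝ (n := ⊤)).contDiffAt).analyticAt
  exact ((analyticAt_const.mul hΦ.rexp').sub analyticAt_const).div hn (hc.norm_sq_pos hx).ne'

/-- **The conical flow is real-analytic on `U`.** -/
theorem analyticAt_conicalField (hx : x ∈ U) : AnalyticAt ℝ (conicalField Φ) x :=
  VertexWitness.analyticAt_grad_add_smul_self (hc.analyticOnNhd x hx) (hc.analyticAt_radialCoeff hx)

/-- `g = ∇Φ` is real-analytic on `U`. -/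
theorem analyticAt_gradient (hx : x ∈ U) : AnalyticAt ℝ g x := by
  have h1 : ContDiffAt ℝ (⊤ : WithTop ℕ∞) Φ x := (hc.analyticOnNhd x hx).contDiffAt
  have h2 : ContDiffAt ℝ (⊤ : WithTop ℕ∞) (fderiv ℝ Φ) x := h1.fderiv_right le_rfl
  have h3 : ContDiffAt ℝ (⊤ : WithTop ℕ∞) (gradient Φ) x := by
    have e : gradient Φ = fun y => (InnerProductSpace.toDual ℝ E3).symm (fderiv ℝ Φ y) := rfl
    rw [e]
    exact (InnerProductSpace.toDual ℝ E3).symm.toContinuousLinearEquiv.contDiff.contDiffAt.comp x h2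
  have hev : gradient Φ =ᶠ[𝓝 x] g := by
    filter_upwards [hc.isOpen.mem_nhds hx] with y hy using hc.gradient_eq hy
  exact (h3.analyticAt.congr hev)

/-- Near a point of `U` the pressure is `h − ½|g|²`. -/
theorem conicalPressure_eventuallyEq (hx : x ∈ U) :
    conicalPressure Φ =ᶠ[𝓝 x] fun y => radialCoeff Φ y - (1 / 2 : ℝ) * ‖g y‖ ^ 2 := by
  filter_upwards [hc.isOpen.mem_nhds hx] with y hy
  rw [conicalPressure, hc.gradient_eq hy]
  ring

/-- **The conical pressure is real-analytic on `U`.** -/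
theorem analyticAt_conicalPressure (hx : x ∈ U) : AnalyticAt ℝ (conicalPressure Φ) x := by
  have hg : ContDiffAt ℝ (⊤ : WithTop ℕ∞) g x := (hc.analyticAt_gradient hx).contDiffAt
  have hn : AnalyticAt ℝ (fun y : E3 => ‖g y‖ ^ 2) x := (hg.norm_sq ℝ).analyticAt
  exact ((hc.analyticAt_radialCoeff hx).sub (analyticAt_const.mul hn)).congr (hc.conicalPressure_eventuallyEq hx).symm

/-- The conical flow is `Cⁿ` on every ball inside `U`. -/
theorem contDiffOn_conicalField_ball {ρ : ℝ} (hball : ball x ρ ⊆ U) {n : WithTop ℕ∞} :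
    ContDiffOn ℝ n (conicalField Φ) (ball x ρ) := fun _ hy =>
  ((hc.analyticAt_conicalField (hball hy)).contDiffAt (n := n)).contDiffWithinAt

/-! ### The Laplacian (local `Δ = −curl curl`) -/

/-- The derivative of the vorticity amplitude `c = 2e^{Φ}/|x|²`: `Dc = ⟪c g − (2c/|x|²) x, ·⟫`. -/
theorem hasFDerivAt_vortAmp (hx : x ∈ U) :
    HasFDerivAt (fun y : E3 => 2 * Real.exp (Φ y) / ‖y‖ ^ 2)
      (innerSL ℝ ((2 * Real.exp (Φ x) / ‖x‖ ^ 2) • g x - (2 * (2 * Real.exp (Φ x) / ‖x‖ ^ 2) / ‖x‖ ^ 2) • x)) x := by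
  have hr := hc.norm_sq_pos hx
  have hnum : HasFDerivAt (fun y : E3 => 2 * Real.exp (Φ y)) ((2 * Real.exp (Φ x)) • innerSL ℝ (g x)) x := by
    have h := (hc.hasFDerivAt_potential x hx).exp.const_mul 2
    refine h.congr_fderiv ?_
    ext v
    simp only [smul_apply, innerSL_apply_apply, smul_eq_mul]
    ring
  have hden : HasFDerivAt (fun y : E3 => ‖y‖ ^ 2) (2 • innerSL ℝ x) x := (hasStrictFDerivAt_norm_sq x).hasFDerivAt
  refine (hasFDerivAt_div hnum hden hr.ne').congr_fderiv ?_
  ext v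
  simp only [sub_apply, smul_apply, innerSL_apply_apply, smul_eq_mul, nsmul_eq_mul, Nat.cast_ofNat, inner_sub_left,
    inner_smul_left, conj_trivial]
  field_simp

/-- **The curl of the vorticity**: `curl ω = −c g + c(h − |g|²) x`. -/
theorem curl_vorticity (hx : x ∈ U) :
    curl (fun y : E3 => (2 * Real.exp (Φ y) / ‖y‖ ^ 2) • cross (g y) y) x =
      -((2 * Real.exp (Φ x) / ‖x‖ ^ 2) • g x) +
        (2 * Real.exp (Φ x) / ‖x‖ ^ 2 * (radialCoeff Φ x - ‖g x‖ ^ 2)) • x := by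
  have hr := hc.norm_sq_pos hx
  have hX : HasFDerivAt (fun y : E3 => cross (g y) y)
      ((crossCLM.precompR E3) (g x) (ContinuousLinearMap.id ℝ E3) + (crossCLM.precompL E3) (H x) x) x :=
    hasFDerivAt_cross (hc.hasFDerivAt_gradient x hx) (hasFDerivAt_id x)
  have hw : HasFDerivAt (fun y : E3 => (2 * Real.exp (Φ y) / ‖y‖ ^ 2) • cross (g y) y)
      ((2 * Real.exp (Φ x) / ‖x‖ ^ 2) •
          ((crossCLM.precompR E3) (g x) (ContinuousLinearMap.id ℝ E3) + (crossCLM.precompL E3) (H x) x) +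
        (innerSL ℝ ((2 * Real.exp (Φ x) / ‖x‖ ^ 2) • g x - (2 * (2 * Real.exp (Φ x) / ‖x‖ ^ 2) / ‖x‖ ^ 2) • x)).smulRight
          (cross (g x) x)) x :=
    (hc.hasFDerivAt_vortAmp hx).smul hX
  have he : ⟪g x, x⟫ = 0 := by rw [real_inner_comm]; exact hc.euler x hx
  rw [curl_eq_curlCLM, hw.fderiv, map_add, map_smul, map_add, curlCLM_precompR_id, curlCLM_precompL, curlCLM_smulRight_innerSL,
    hc.hessian_apply_self hx, hc.trace_hessian hx, cross_smul_sub_smul_left, cross_cross_eq, cross_cross_eq, real_inner_self_eq_norm_sq,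
    real_inner_self_eq_norm_sq, hc.euler x hx, he]
  have hn := hc.norm_ne_zero hx
  ext i
  simp only [PiLp.add_apply, PiLp.sub_apply, PiLp.neg_apply, PiLp.smul_apply, smul_eq_mul, zero_mul]
  field_simp
  ring

/-- ★ **The Laplacian of the conical flow**: `Δu = c g + c(|g|² − h) x`, `c = 2e^{Φ}/|x|²`. -/
theorem laplacian_conicalField (hx : x ∈ U) :
    Laplacian.laplacian (conicalField Φ) x =
      (2 * Real.exp (Φ x) / ‖x‖ ^ 2) • g x + (2 * Real.exp (Φ x) / ‖x‖ ^ 2 * (‖g x‖ ^ 2 - radialCoeff Φ x)) • x := by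
  obtain ⟨ρ, hρ, hball⟩ := Metric.isOpen_iff.1 hc.isOpen x hx
  rw [LocalCurlCurl.laplacian_eq_neg_curl_local hρ (hc.contDiffOn_conicalField_ball hball)
    (fun y hy => hc.divergence_conicalField (hball hy))
    (w := fun y : E3 => (2 * Real.exp (Φ y) / ‖y‖ ^ 2) • cross (g y) y) (fun y hy => hc.curl_conicalField (hball hy)),
    hc.curl_vorticity hx, neg_add, neg_neg, ← neg_smul]
  congr 1
  ring_nf

/-! ### The pressure gradient and the momentum equation -/

/-- **The pressure gradient**: `∇p = c g − (2h/|x|²) x − H g`. -/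
theorem gradient_conicalPressure (hx : x ∈ U) :
    gradient (conicalPressure Φ) x =
      (2 * Real.exp (Φ x) / ‖x‖ ^ 2) • g x - (2 * radialCoeff Φ x / ‖x‖ ^ 2) • x - H x (g x) := by
  have hD : HasFDerivAt (fun y : E3 => radialCoeff Φ y - (1 / 2 : ℝ) * ‖g y‖ ^ 2)
      (dRadial Φ g x - (1 / 2 : ℝ) • (2 • (innerSL ℝ (g x)).comp (H x))) x :=
    (hc.hasFDerivAt_radialCoeff hx).sub (((hc.hasFDerivAt_gradient x hx).norm_sq).const_mul (1 / 2 : ℝ))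
  have hD' := hD.congr_of_eventuallyEq (hc.conicalPressure_eventuallyEq hx)
  apply gradient_eq_of_hasFDerivAt_innerSL
  refine hD'.congr_fderiv ?_
  ext v
  rw [dRadial_eq_innerSL]
  have hs := hc.hessian_symm hx (g x) v
  simp only [sub_apply, smul_apply, innerSL_apply_apply, ContinuousLinearMap.coe_comp, Function.comp_apply, inner_sub_left,
    smul_eq_mul] at hs ⊢
  simp [hs]

/-- The convective term: `Du(u) = H g + (c|g|² − h²) x`. -/
theorem fderiv_conicalField_apply_conicalField (hx : x ∈ U) :
    fderiv ℝ (conicalField Φ) x (conicalField Φ x) =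
      H x (g x) + (2 * Real.exp (Φ x) / ‖x‖ ^ 2 * ‖g x‖ ^ 2 - radialCoeff Φ x ^ 2) • x := by
  have hr := hc.norm_sq_pos hx
  have he : ⟪g x, x⟫ = 0 := by rw [real_inner_comm]; exact hc.euler x hx
  rw [hc.fderiv_conicalField hx, hc.conicalField_eq hx, dField]
  simp only [map_add, map_smul, add_apply, smul_apply, ContinuousLinearMap.id_apply, ContinuousLinearMap.smulRight_apply,
    hc.hessian_apply_self hx, hc.dRadial_apply_self hx]
  rw [dRadial_eq_innerSL]
  have he' : ⟪x, g x⟫ = 0 := hc.euler x hx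
  simp only [innerSL_apply_apply, inner_sub_left, inner_smul_left, conj_trivial, real_inner_self_eq_norm_sq, he']
  ext i
  simp only [PiLp.add_apply, PiLp.smul_apply, PiLp.neg_apply, smul_eq_mul]
  field_simp
  ring

/-- ★ **The momentum equation** `Du(u) + ∇p = Δu` on `U` (it closes on `c h = h² + 2h/|x|²`). -/
theorem momentum (hx : x ∈ U) :
    fderiv ℝ (conicalField Φ) x (conicalField Φ x) + gradient (conicalPressure Φ) x = Laplacian.laplacian (conicalField Φ) x := by
  have hr := hc.norm_sq_pos hx
  have key : 2 * Real.exp (Φ x) / ‖x‖ ^ 2 * radialCoeff Φ x = radialCoeff Φ x ^ 2 + 2 * radialCoeff Φ x / ‖x‖ ^ 2 := by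
    rw [hc.two_exp_div hx]
    ring
  rw [hc.fderiv_conicalField_apply_conicalField hx, hc.gradient_conicalPressure hx, hc.laplacian_conicalField hx]
  ext i
  simp only [PiLp.add_apply, PiLp.sub_apply, PiLp.smul_apply, smul_eq_mul]
  linear_combination (x i) * key

/-! ### Assembly -/

/-- ★ **The conical flow is a classical steady Navier–Stokes flow on `U`.** -/
theorem isSteadyNSOn : IsSteadyNSOn U (conicalField Φ) (conicalPressure Φ) := by
  refine ⟨?_, ?_, ?_, ?_⟩
  · exact fun y hy => ((hc.analyticAt_conicalField hy).contDiffAt (n := 3)).contDiffWithinAt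
  · exact fun y hy => ((hc.analyticAt_conicalPressure hy).contDiffAt (n := 1)).contDiffWithinAt
  · exact fun y hy => hc.divergence_conicalField hy
  · exact fun y hy => hc.momentum hy

/-- ★ The conical flow is real-analytic on `U`. -/
theorem analyticOnNhd_conicalField : AnalyticOnNhd ℝ (conicalField Φ) U := fun _ hy => hc.analyticAt_conicalField hy

/-- ★ The conical pressure is real-analytic on `U`. -/
theorem analyticOnNhd_conicalPressure : AnalyticOnNhd ℝ (conicalPressure Φ) U := fun _ hy => hc.analyticAt_conicalPressure hy

/-- ★ The conical flow is unthreaded about the vertex on `U`. -/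
theorem isUnthreadedOn : IsUnthreadedOn U 0 (conicalField Φ) := fun _ hy => hc.inner_curl_conicalField hy

/-- ★ The conical flow is homogeneous of degree `−1` about the vertex on `U`. -/
theorem isMinusOneHomogeneousOn : IsMinusOneHomogeneousOn U 0 (conicalField Φ) := fun _ hy =>
  hc.fderiv_conicalField_apply_self hy

/-- ★★ **Šverák's correspondence, constructive direction.**  Liouville data on an open cone `U ∌ 0` produce a real-analytic classical
steady Navier–Stokes flow on `U`, unthreaded and `(−1)`-homogeneous about the vertex, with vorticity `(2e^{Φ}/|x|²)(∇Φ × x)`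
(so `curl ≢ 0` exactly where `∇Φ ≠ 0`).  [Šverák 2011 §3–§4 proves the converse for flows smooth on all of `S²`.] -/
theorem correspondence :
    AnalyticOnNhd ℝ (conicalField Φ) U ∧ AnalyticOnNhd ℝ (conicalPressure Φ) U ∧ IsSteadyNSOn U (conicalField Φ) (conicalPressure Φ) ∧
      IsUnthreadedOn U 0 (conicalField Φ) ∧ IsMinusOneHomogeneousOn U 0 (conicalField Φ) ∧
      ∀ y ∈ U, curl (conicalField Φ) y = (2 * Real.exp (Φ y) / ‖y‖ ^ 2) • cross (g y) y :=
  ⟨hc.analyticOnNhd_conicalField, hc.analyticOnNhd_conicalPressure, hc.isSteadyNSOn, hc.isUnthreadedOn, hc.isMinusOneHomogeneousOn,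
    fun _ hy => hc.curl_conicalField hy⟩

end LiouvilleCone

end Summit.NavierStokesRegularity.NavierStokesRegularity.Theorems.PoloidalLiouville.AzimuthalCartan

end
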